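import Summits.CriticalPhenomena.PercolationContinuityZ3.Theorems.PercNearOneGluingNoHeavyQuantFarSunSharpRatioTail
import Summits.CriticalPhenomena.PercolationContinuityZ3.Theorems.PercNearOneGluingNoHeavyQuantFarSunSharpLayerThree
import HarnessLib

/-!
# FAR beyond trees: LAYER 3 with the Poisson-ratio deficit — `Σ ≥ 69/4 ⇒ G_avg ≥ 1` at layer `3` and `HairyCycle.sunFAR_three_of_ge_eightythree :
# 83 ≤ K → SunFAR K 3`; the point is the region bound `η > 3F/(Σ₀ − 3) ≈ 0.21` on `R_3 ∩ {Σ < Σ₀}`, which lowers the prefix box of the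
# layer-3 closure plan from `K₁ = 25` to `K₁ = 24` (memo §4: `η₀(24,3) = 0.2044 < 0.2105`)

builds on p205010 (kernel theorem, internal audit signed; external expert review pending)

Support file (`--supports stmt-CriticalPhenomena-4575`), seat `prim-cert-1` (gen 42); memo `prim-cert-1/FROM-prim-cert-1-g42-SHARP-LARGEK.md` §2, §4.
* `HairyCycle.witGavg_congr` — `witGavg K h j` depends on `h` only through `h k`, `k < K`.
* **`HairyCycle.witGavg_ge_one_ratio`** — LEMMA 1 with free parameters as `witGavg_ge_one_sharp` (…SharpWitAvg), but with the deficit bounded by the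
  Poisson-ratio tail `P = γ₀/(S₀ + γ₀)` of `noWit_erase_le_ratio` (…SharpRatioTail; `γ₀ = U₀/(U₀ − 2j)`, `S₀ = Σ_{t<n} U₀^{t+1}(2j)!/(2j+t+1)!`,
  `2j < U₀ ≤ Σ − 1`, `2j + n ≤ U₀`) instead of Chernoff.
* `HairyCycle.witGavg_ge_one_three'` — `0 < h ≤ 1` on `range K`, `Σ_{k<K} h k ≥ 69/4` ⟹ `witGavg K h 3 ≥ 1` (`M = 4`, `θ₂ = 1/2`, `ρ = 9/20`,
  `U₀ = 65/4`, `n = 10`: `P ≤ 33/5000`); was `Σ ≥ 18` (…SharpLayerThree).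
* **`HairyCycle.sunFAR_three_of_ge_eightythree`** — `SunFAR K 3` for every `K ≥ 83` (was `91`); graph forms `farRelayRow_{hairyCycle,ring}_three_of_ge_eightythree`.
No definitions, no sorries, standard axioms.  [this work]
[cite: KozmaNitzan2024, Conjecture 3 (p. 15)] (context: the lower-tail family FAR serves).
-/

noncomputable section

namespace Summit.CriticalPhenomena.PercolationContinuityZ3.Theorems.HairyCycle

open Finset
open scoped Classical

variable {K : ℕ}

/-- `witGavg K h j` depends on `h` only on `range K`. [this work] -/
theorem witGavg_congr {h h' : ℕ → ℝ} (he : ∀ k, k < K → h' k = h k) (j : ℕ) : witGavg K h' j = witGavg K h j := by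
  unfold witGavg witGW witMassW
  refine Finset.sum_congr rfl fun k hk => ?_
  rw [he k (Finset.mem_range.1 hk)]
  congr 1
  exact Finset.sum_congr rfl fun Q _ => by rw [hairW_congr he Q]

/-! ## LEMMA 1 with free parameters, Poisson-ratio deficit -/

/-- **LEMMA 1 at layer `j ≥ 1`, free parameters, Poisson-ratio deficit.**  Let `0 ≤ h ≤ 1` everywhere and `0 < h` on `range K`, `Σ = Σ_{k<K} h k`,
reals `M ≥ j`, `θ₂ ∈ (0,1]`, `0 < ρ ≤ 1 − e^{−(1−θ₂)M}/θ₂^{j−1}`, `N₀ := Σ − 2M − 2 − 2j > 0`, a real `U₀` with `2j < U₀ ≤ Σ − 1` and a natural `n` with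
`2j + n ≤ U₀`; put `γ₀ = U₀/(U₀ − 2j)`, `S₀ = Σ_{t<n} U₀^{t+1}(2j)!/(2j+t+1)!`, `P = γ₀/(S₀ + γ₀)`.  If `P·(Σ − (2j−1)ρ) ≤ N₀ρ³` then `witGavg K h j ≥ 1`. [this work] -/
theorem witGavg_ge_one_ratio {h : ℕ → ℝ} (hh01 : ∀ i, 0 ≤ h i ∧ h i ≤ 1) (hh : ∀ k, k < K → 0 < h k ∧ h k ≤ 1) {j : ℕ} (hj : 1 ≤ j)
    {M θ₂ ρ U₀ : ℝ} {n : ℕ} (hMj : (j : ℝ) ≤ M) (hθ₂0 : 0 < θ₂) (hθ₂1 : θ₂ ≤ 1)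
    (hρ0 : 0 < ρ) (hρ : ρ ≤ 1 - Real.exp (-(1 - θ₂) * M) / θ₂ ^ (j - 1))
    (hN : 0 < ∑ k ∈ range K, h k - 2 * M - 2 - 2 * j)
    (hc : (2 * j : ℝ) < U₀) (hU₀ : U₀ ≤ ∑ k ∈ range K, h k - 1) (hn : ((2 * j + n : ℕ) : ℝ) ≤ U₀)
    (hnum : (U₀ / (U₀ - 2 * j)) /
        (∑ t ∈ Finset.range n, U₀ ^ (t + 1) * ((2 * j).factorial : ℝ) / ((2 * j + t + 1).factorial : ℝ) + U₀ / (U₀ - 2 * j)) *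
        (∑ k ∈ range K, h k - (2 * j - 1) * ρ) ≤ (∑ k ∈ range K, h k - 2 * M - 2 - 2 * j) * ρ ^ 3) :
    1 ≤ witGavg K h j := by
  have hh' : ∀ k, k < K → 0 ≤ h k ∧ h k ≤ 1 := fun k hk => ⟨(hh k hk).1.le, (hh k hk).2⟩
  set S := ∑ k ∈ range K, h k with hSdef
  set N₀ := S - 2 * M - 2 - 2 * j with hN₀def
  set P := (U₀ / (U₀ - 2 * j)) /
        (∑ t ∈ Finset.range n, U₀ ^ (t + 1) * ((2 * j).factorial : ℝ) / ((2 * j + t + 1).factorial : ℝ) + U₀ / (U₀ - 2 * j)) with hPdef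
  have hj' : (1 : ℝ) ≤ j := by exact_mod_cast hj
  have hM0 : 0 ≤ M := le_trans (by linarith) hMj
  have hρ1 : ρ ≤ 1 := by
    have : 0 ≤ Real.exp (-(1 - θ₂) * M) / θ₂ ^ (j - 1) := div_nonneg (Real.exp_pos _).le (pow_nonneg hθ₂0.le _)
    linarith
  have hden : 0 < S - (2 * j - 1) * ρ := by nlinarith
  -- central positions (threshold `M`)
  set Cen := (range K).filter (fun k => M ≤ ∑ i ∈ range k, h i ∧ M ≤ ∑ i ∈ (range K).filter (fun i => k < i), h i) with hCendef
  have hCen := card_central_gt_gen hh' (M := M) hM0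
  rw [← hSdef, ← hCendef] at hCen
  refine witGavg_ge_one_of_charging hh j (fun k => if k ∈ Cen then 1 else 0) hN (fun H hH hne => ?_) (fun k hk => ?_)
  · -- cover: `N₀ ≤ #(Cen ∖ H)`
    have hHc : H.card ≤ 2 * j := card_le_of_wit_not_nonempty hne
    have hsum : ∑ k ∈ range K \ H, (if k ∈ Cen then (1 : ℝ) else 0) = (((range K \ H).filter (fun k => k ∈ Cen)).card : ℝ) := by
      rw [Finset.sum_boole]
    rw [hsum]
    have hsub : Cen \ H ⊆ (range K \ H).filter (fun k => k ∈ Cen) := by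
      intro k hk
      rw [Finset.mem_sdiff] at hk
      exact Finset.mem_filter.2 ⟨Finset.mem_sdiff.2 ⟨(Finset.mem_filter.1 hk.1).1, hk.2⟩, hk.1⟩
    have hc1 : ((Cen \ H).card : ℝ) ≤ (((range K \ H).filter (fun k => k ∈ Cen)).card : ℝ) := by
      exact_mod_cast Finset.card_le_card hsub
    have hc2 : (Cen.card : ℝ) - 2 * j ≤ ((Cen \ H).card : ℝ) := by
      have h' : Cen.card - H.card ≤ (Cen \ H).card := Finset.le_card_sdiff H Cen
      have h2j : (H.card : ℝ) ≤ 2 * j := by exact_mod_cast hHc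
      have : (Cen.card : ℝ) - (H.card : ℝ) ≤ ((Cen.card - H.card : ℕ) : ℝ) := by
        rcases le_or_gt H.card Cen.card with hle | hgt
        · rw [Nat.cast_sub hle]
        · rw [Nat.sub_eq_zero_of_le hgt.le]; push_cast; linarith [(Nat.cast_lt (α := ℝ)).2 hgt]
      have h'' : ((Cen.card - H.card : ℕ) : ℝ) ≤ ((Cen \ H).card : ℝ) := by exact_mod_cast h'
      linarith
    change S - 2 * M - 2 - 2 * j ≤ _
    linarith
  · -- comparison: `ω_k d_k ≤ N₀ · a_k`
    have ha0 : 0 ≤ ∑ Q ∈ ((range K).erase k).powerset, hairW K h Q * witAvgKernel j (insert k Q) k :=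
      Finset.sum_nonneg fun Q _ => mul_nonneg (hairW_nonneg hh' Q) (by
        unfold witAvgKernel; split_ifs
        · exact div_nonneg zero_le_one (Nat.cast_nonneg _)
        · exact le_rfl)
    by_cases hkC : k ∈ Cen
    · rw [if_pos hkC, one_mul]
      have hkC' := hkC
      rw [hCendef, Finset.mem_filter] at hkC'
      -- `d_k = (1 − h k)·D⁰_k`, `D⁰_k ≤ P`
      have hd : ∑ Q ∈ ((range K).erase k).powerset, hairW K h Q * (if (wit j Q).Nonempty then (0 : ℝ) else 1) =
          (1 - h k) * ∑ Q ∈ ((range K).erase k).powerset, hairW K (Function.update h k 0) Q * (if (wit j Q).Nonempty then (0 : ℝ) else 1) := by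
        rw [Finset.mul_sum]
        refine Finset.sum_congr rfl fun Q hQ => ?_
        rw [Finset.mem_powerset] at hQ
        rw [hairW_eq_mul_erase h hk (fun hm => Finset.notMem_erase k _ (hQ hm))]
        ring
      have hDP := noWit_erase_le_ratio hh01 j hk n hc (by rw [← hSdef]; exact hU₀) hn
      rw [← hPdef] at hDP
      -- `a_k ≥ (1 − h k) ρ³/(S − (2j−1)ρ)`
      have ha := boost_ge_sharp hh' hj hk hMj hθ₂0 hθ₂1 hρ0 hρ hkC'.2.1 hkC'.2.2
      rw [← hSdef] at ha
      have hu : 0 ≤ 1 - h k := by linarith [(hh k hk).2]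
      have hPN : P ≤ N₀ * ρ ^ 3 / (S - (2 * j - 1) * ρ) := by
        rw [le_div_iff₀ hden]; exact hnum
      rw [hd]
      calc (1 - h k) * ∑ Q ∈ ((range K).erase k).powerset,
            hairW K (Function.update h k 0) Q * (if (wit j Q).Nonempty then (0 : ℝ) else 1)
          ≤ (1 - h k) * P := mul_le_mul_of_nonneg_left hDP hu
        _ ≤ (1 - h k) * (N₀ * ρ ^ 3 / (S - (2 * j - 1) * ρ)) := mul_le_mul_of_nonneg_left hPN hu
        _ = N₀ * ((1 - h k) * ρ ^ 3 / (S - (2 * j - 1) * ρ)) := by ring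
        _ ≤ N₀ * ∑ Q ∈ ((range K).erase k).powerset, hairW K h Q * witAvgKernel j (insert k Q) k :=
            mul_le_mul_of_nonneg_left ha hN.le
    · rw [if_neg hkC, zero_mul]
      exact mul_nonneg hN.le ha0

/-! ## Layer 3 from `Σ ≥ 69/4` -/

/-- The Poisson-ratio deficit constant at layer `3` with `U₀ = 65/4`, `n = 10` is at most `33/5000`. [this work] -/
theorem ratio_deficit_three_le :
    ((65 / 4 : ℝ) / (65 / 4 - 2 * ((3 : ℕ) : ℝ))) /
        (∑ t ∈ Finset.range 10, (65 / 4 : ℝ) ^ (t + 1) * ((2 * 3).factorial : ℝ) / ((2 * 3 + t + 1).factorial : ℝ) +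
          (65 / 4 : ℝ) / (65 / 4 - 2 * ((3 : ℕ) : ℝ))) ≤ 33 / 5000 := by
  simp only [Finset.sum_range_succ, Finset.sum_range_zero, Nat.factorial, Nat.cast_ofNat]
  norm_num

/-- **LEMMA 1 at layer 3, improved**: `0 ≤ h ≤ 1` everywhere, `0 < h` on `range K` and `Σ_{k<K} h k ≥ 69/4` give `witGavg K h 3 ≥ 1`. [this work] -/
theorem witGavg_ge_one_three_ratio {h : ℕ → ℝ} (hh01 : ∀ i, 0 ≤ h i ∧ h i ≤ 1) (hh : ∀ k, k < K → 0 < h k ∧ h k ≤ 1)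
    (hS : (69 / 4 : ℝ) ≤ ∑ k ∈ range K, h k) : 1 ≤ witGavg K h 3 := by
  have hP := ratio_deficit_three_le
  refine witGavg_ge_one_ratio hh01 hh (j := 3) (by norm_num) (M := 4) (θ₂ := 1 / 2) (ρ := 9 / 20) (U₀ := 65 / 4) (n := 10)
    (by norm_num) (by norm_num) (by norm_num) (by norm_num) rho_three_le ?_ ?_ ?_ ?_ ?_
  · push_cast; linarith
  · push_cast; norm_num
  · linarith
  · push_cast; norm_num
  · set S := ∑ k ∈ range K, h k with hSdef
    set P := ((65 / 4 : ℝ) / (65 / 4 - 2 * ((3 : ℕ) : ℝ))) /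
        (∑ t ∈ Finset.range 10, (65 / 4 : ℝ) ^ (t + 1) * ((2 * 3).factorial : ℝ) / ((2 * 3 + t + 1).factorial : ℝ) +
          (65 / 4 : ℝ) / (65 / 4 - 2 * ((3 : ℕ) : ℝ))) with hPdef
    have hP0 : 0 ≤ P := by
      rw [hPdef]
      refine div_nonneg (by norm_num) (add_nonneg (Finset.sum_nonneg fun t _ => by positivity) (by norm_num))
    have h1 : P * (S - (2 * ((3 : ℕ) : ℝ) - 1) * (9 / 20)) ≤ 33 / 5000 * (S - (2 * ((3 : ℕ) : ℝ) - 1) * (9 / 20)) :=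
      mul_le_mul_of_nonneg_right hP (by push_cast; linarith)
    push_cast at h1 ⊢
    nlinarith

/-- **LEMMA 1 at layer 3, improved, for `h` given on `range K` only**: `0 < h ≤ 1` on `range K`, `Σ ≥ 69/4` ⟹ `witGavg K h 3 ≥ 1`. [this work] -/
theorem witGavg_ge_one_three' {h : ℕ → ℝ} (hh : ∀ k, k < K → 0 < h k ∧ h k ≤ 1) (hS : (69 / 4 : ℝ) ≤ ∑ k ∈ range K, h k) :
    1 ≤ witGavg K h 3 := by
  set h' : ℕ → ℝ := fun k => if k < K then h k else 0 with hh'def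
  have he : ∀ k, k < K → h' k = h k := fun k hk => by rw [hh'def]; simp only [hk, if_true]
  have hh01 : ∀ i, 0 ≤ h' i ∧ h' i ≤ 1 := by
    intro i
    by_cases hi : i < K
    · rw [he i hi]; exact ⟨(hh i hi).1.le, (hh i hi).2⟩
    · rw [hh'def]; simp only [hi, if_false]; norm_num
  have hh' : ∀ k, k < K → 0 < h' k ∧ h' k ≤ 1 := fun k hk => by rw [he k hk]; exact hh k hk
  have hsum : ∑ k ∈ range K, h' k = ∑ k ∈ range K, h k := Finset.sum_congr rfl fun k hk => he k (Finset.mem_range.1 hk)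
  rw [← witGavg_congr he 3]
  exact witGavg_ge_one_three_ratio hh01 hh' (by rw [hsum]; exact hS)

/-! ## The theorem -/

/-- **LAYER 3 OF FAR ON ALL HAIRY CYCLES WITH `K ≥ 83` HAIRS**: `SunFAR K 3` for every `K ≥ 83`. [this work] -/
theorem sunFAR_three_of_ge_eightythree {K : ℕ} (hK : 83 ≤ K) : SunFAR K 3 := by
  have hK2 : 2 ≤ K := by omega
  refine sunFAR_of_witGavg_from_all (j := 3) (by norm_num) K hK2 (fun K' hK' h hh m hm hmin hS2j hR => ?_) K le_rfl
  set h' : ℕ → ℝ := fun k => if k < K' then h k else 0 with hh'def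
  have he : ∀ k, k < K' → h' k = h k := fun k hk => by rw [hh'def]; simp only [hk, if_true]
  have hh' : ∀ k, 0 ≤ h' k ∧ h' k ≤ 1 := by
    intro k
    by_cases hk : k < K'
    · rw [he k hk]; exact hh k hk
    · rw [hh'def]; simp only [hk, if_false]; norm_num
  have hsum : ∑ k ∈ range K', h' k = ∑ k ∈ range K', h k :=
    Finset.sum_congr rfl fun k hk => he k (Finset.mem_range.1 hk)
  have hF : hairV K' h' 3 (range K') = hairV K' h 3 (range K') := hairV_congr he 3 (range K')
  have hL2 := jKF_lt_of_R (K := K') hh' (j := 3) (by norm_num) hm (fun k hk => by rw [he m hm, he k hk]; exact hmin k hk)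
    (by rw [hsum]; exact hS2j) (by rw [hsum, hF, he m hm]; exact hR)
  rw [hsum, hF, he m hm] at hL2
  obtain ⟨hjKF, hjK, hηpos⟩ := hL2
  push_cast at hjKF hjK
  set S := ∑ k ∈ range K', h k with hSdef
  set F := hairV K' h 3 (range K') with hFdef
  have hS0 : 0 ≤ S := Finset.sum_nonneg fun k hk => (hh k (Finset.mem_range.1 hk)).1
  have hK'r : (83 : ℝ) ≤ K' := by exact_mod_cast hK.trans hK'
  have hhpos : ∀ k, k < K' → 0 < h k ∧ h k ≤ 1 := fun k hk => ⟨lt_of_lt_of_le hηpos (hmin k hk), (hh k hk).2⟩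
  have hSig : (69 / 4 : ℝ) ≤ S := by
    by_contra hlt
    push Not at hlt
    rcases le_or_gt S 15 with hS15 | hS15
    · have h1 : S * (S + 1) ≤ 15 * 16 := by nlinarith
      nlinarith
    · have hF1 := hairV_univ_ge_chernoff hh 3
      rw [← hSdef, ← hFdef] at hF1
      have hexp : (4 : ℝ) ^ 3 * Real.exp (-(3 / 4) * S) ≤ 1 / 1000 := by
        refine le_trans ?_ exp_neg_fortyfive_quarters_le
        rw [show (4 : ℝ) ^ 3 = 64 by norm_num]
        exact mul_le_mul_of_nonneg_left (Real.exp_le_exp.2 (by linarith)) (by norm_num)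
      have hF999 : (999 / 1000 : ℝ) ≤ F := by linarith
      have hK'0 : (0 : ℝ) ≤ 3 * (K' : ℝ) := by positivity
      have h1 : 3 * (K' : ℝ) * (999 / 1000) ≤ 3 * (K' : ℝ) * F := mul_le_mul_of_nonneg_left hF999 hK'0
      have h2 : S * (S - 3) < (69 / 4) * (57 / 4) := by nlinarith
      nlinarith
  exact witGavg_ge_one_three' hhpos hSig

/-! ## Graph forms -/

open MeasureTheory
open Literature.Probability.Percolation Literature.Probability.LatticeModels
open Summit.CriticalPhenomena.PercolationContinuityZ3.Theorems.TwoCopy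

/-- **FAR at layer 3 on every hairy cycle with `K ≥ 83` pendant relays**, all weights. [this work] -/
theorem farRelayRow_hairyCycle_three_of_ge_eightythree {n L K : ℕ} {cyc : ℕ → Fin n} {base : ℕ → ℕ} {tip : ℕ → Fin n}
    (H : IsHairyCycle L cyc K base tip) (hK : 83 ≤ K) (w : Sym2 (Fin n) → unitInterval)
    (hsupp : ∀ e : Sym2 (Fin n), ¬ e.IsDiag → w e ≠ 0 →
      (∃ i, i < L ∧ e = cycE L cyc i) ∨ (∃ k, k < K ∧ e = hairE cyc base tip k))
    (t : ℝ)
    (hEN : (2 * (3 : ℕ) : ℝ) < ∑ a ∈ (Finset.range K).image tip, (prodBernoulli w).real (openConn (cyc 0) a))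
    (hcut : ∀ a ∈ (Finset.range K).image tip, (prodBernoulli w).real (openConn (cyc 0) a)ᶜ ≤ t) :
    (prodBernoulli w).real {ω : BondConfig (Fin n) |
      (((Finset.range K).image tip).filter fun a => ω ∈ openConn (cyc 0) a).card ≤ 3} ≤ t :=
  farRelayRow_hairyCycle_of_sunFAR H (sunFAR_three_of_ge_eightythree hK) w hsupp t hEN hcut

/-- **FAR at layer 3 on every RING with `K ≥ 83` relays**, all weights supported on the cycle and proper hair edges. [this work] -/
theorem farRelayRow_ring_three_of_ge_eightythree {n L K : ℕ} {cyc : ℕ → Fin n} {base : ℕ → ℕ} {tip : ℕ → Fin n}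
    (H : IsHairyCycleD L cyc K base tip) (hK : 83 ≤ K) (w : Sym2 (Fin n) → unitInterval)
    (hsupp : ∀ e : Sym2 (Fin n), ¬ e.IsDiag → w e ≠ 0 →
      (∃ i, i < L ∧ e = cycE L cyc i) ∨ (∃ k, k < K ∧ e = hairE cyc base tip k))
    (t : ℝ)
    (hEN : (2 * (3 : ℕ) : ℝ) < ∑ a ∈ (Finset.range K).image tip, (prodBernoulli w).real (openConn (cyc 0) a))
    (hcut : ∀ a ∈ (Finset.range K).image tip, (prodBernoulli w).real (openConn (cyc 0) a)ᶜ ≤ t) :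
    (prodBernoulli w).real {ω : BondConfig (Fin n) |
      (((Finset.range K).image tip).filter fun a => ω ∈ openConn (cyc 0) a).card ≤ 3} ≤ t :=
  farRelayRow_ring_of_sunFAR H (sunFAR_three_of_ge_eightythree hK) w hsupp t hEN hcut

end Summit.CriticalPhenomena.PercolationContinuityZ3.Theorems.HairyCycle

end
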